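import Mathlib

/-!
# A self-adjoint operator of finite rank is a finite sum over an orthonormal basis of its range (support, seat p1)

For a bounded self-adjoint operator `T` on a Hilbert space `H` whose range `V` is finite-dimensional, and an
orthonormal basis `b` of `V`,

  `T x = ∑ i, ⟪b i, x⟫ • T (b i)`   for every `x ∈ H`   (`apply_eq_sum`),

hence `⟪T x, y⟫ = ∑ i, ⟪b i, x⟫ · ⟪T (b i), y⟫` (`inner_apply_eq_sum`): `T` is the FINITE sum of the rank-one
operators `x ↦ ⟪b i, x⟫ T (b i)`. Proof: `x − ∑ ⟪b i, x⟫ b i` is orthogonal to `V` (`sub_component_mem_orthogonal`),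
and a self-adjoint `T` kills `Vᗮ` (`apply_eq_zero_of_mem_orthogonal`: `‖T y‖² = ⟪y, T (T y)⟫ = 0` since
`T (T y) ∈ V`).

This is the abstract form of the spectral kernel in the two-kernel derivation of a two-period identity
(STATUS l. 14985 (2)(b) / crit-1 l. 15006 R2): with `H = L²([G])`, `T = R(f)` for a symmetric `f` (`f* = f`),
`V = range R(f)` finite-dimensional (finitely many automorphic representations of a given level and archimedean
type, each with finite multiplicity — printed), the operator is the finite sum `Σ_{φ ∈ ONB(V)} ⟪φ, ·⟫ R(f)φ`,
whose kernel is `Σ_φ (R(f)φ)(x) conj φ(y)`. Nothing here is about any group, any period, or (N).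

Blind lane: Mathlib only; no sorry; axioms ⊆ {propext, Classical.choice, Quot.sound}.
-/

namespace Summit.Ventures.HodgeRepro2.T7SupportFiniteRankSelfAdjoint

open scoped InnerProductSpace
open Finset

variable {H : Type*} [NormedAddCommGroup H] [InnerProductSpace ℂ H]

/-- the range of a bounded operator, as a submodule -/
abbrev range (T : H →L[ℂ] H) : Submodule ℂ H := LinearMap.range (T : H →ₗ[ℂ] H)

/-- `T x ∈ range T` -/
theorem apply_mem_range (T : H →L[ℂ] H) (x : H) : T x ∈ range T :=
  LinearMap.mem_range.2 ⟨x, rfl⟩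

/-- **a self-adjoint operator kills the orthogonal complement of its range** -/
theorem apply_eq_zero_of_mem_orthogonal [CompleteSpace H] (T : H →L[ℂ] H) (hT : IsSelfAdjoint T) {y : H}
    (hy : y ∈ (range T)ᗮ) : T y = 0 := by
  have hadj : ContinuousLinearMap.adjoint T = T := ContinuousLinearMap.isSelfAdjoint_iff'.1 hT
  have h : ⟪T y, T y⟫_ℂ = 0 := by
    have e : ⟪T y, T y⟫_ℂ = ⟪y, T (T y)⟫_ℂ :=
      calc ⟪T y, T y⟫_ℂ = ⟪ContinuousLinearMap.adjoint T y, T y⟫_ℂ := by rw [hadj]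
        _ = ⟪y, T (T y)⟫_ℂ := ContinuousLinearMap.adjoint_inner_left T (T y) y
    rw [e]
    exact (Submodule.mem_orthogonal' _ _).1 hy _ (apply_mem_range T (T y))
  exact inner_self_eq_zero.1 h

variable {ι : Type*} [Fintype ι]

/-- the orthonormal-basis component of `x` in the range -/
noncomputable def component (T : H →L[ℂ] H) (b : OrthonormalBasis ι ℂ (range T)) (x : H) : H :=
  ∑ i, ⟪(b i : H), x⟫_ℂ • (b i : H)

/-- the component lies in the range -/
theorem component_mem (T : H →L[ℂ] H) (b : OrthonormalBasis ι ℂ (range T)) (x : H) :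
    component T b x ∈ range T :=
  Submodule.sum_mem _ fun i _ => Submodule.smul_mem _ _ (b i).2

/-- `⟪b j, component x⟫ = ⟪b j, x⟫` (orthonormality) -/
theorem inner_basis_component (T : H →L[ℂ] H) (b : OrthonormalBasis ι ℂ (range T)) (x : H) (j : ι) :
    ⟪(b j : H), component T b x⟫_ℂ = ⟪(b j : H), x⟫_ℂ := by
  classical
  unfold component
  rw [inner_sum]
  have horth : ∀ i, ⟪(b j : H), (b i : H)⟫_ℂ = if j = i then 1 else 0 := fun i => by
    have h := orthonormal_iff_ite.1 b.orthonormal j i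
    rwa [Submodule.coe_inner] at h
  simp only [inner_smul_right, horth, mul_ite, mul_one, mul_zero]
  rw [sum_ite_eq, if_pos (mem_univ _)]

/-- **`x − component x` is orthogonal to the range** -/
theorem sub_component_mem_orthogonal (T : H →L[ℂ] H) (b : OrthonormalBasis ι ℂ (range T)) (x : H) :
    x - component T b x ∈ (range T)ᗮ := by
  rw [Submodule.mem_orthogonal]
  intro u hu
  -- expand `u` in the basis
  have hu' : (⟨u, hu⟩ : range T) = ∑ i, (b.repr ⟨u, hu⟩).ofLp i • b i := (b.sum_repr _).symm
  have e : u = ∑ i, (b.repr ⟨u, hu⟩).ofLp i • (b i : H) := by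
    have := congrArg (fun v : range T => (v : H)) hu'
    simpa using this
  rw [e, sum_inner]
  refine sum_eq_zero fun i _ => ?_
  rw [inner_smul_left, inner_sub_right, inner_basis_component, sub_self, mul_zero]

/-- **the finite-rank formula**: `T x = ∑ i, ⟪b i, x⟫ • T (b i)` for `T` self-adjoint with finite-dimensional
range and `b` an orthonormal basis of the range. -/
theorem apply_eq_sum [CompleteSpace H] (T : H →L[ℂ] H) (hT : IsSelfAdjoint T)
    (b : OrthonormalBasis ι ℂ (range T)) (x : H) :
    T x = ∑ i, ⟪(b i : H), x⟫_ℂ • T (b i) := by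
  have h0 : T (x - component T b x) = 0 :=
    apply_eq_zero_of_mem_orthogonal T hT (sub_component_mem_orthogonal T b x)
  rw [map_sub, sub_eq_zero] at h0
  rw [h0]
  unfold component
  rw [map_sum]
  simp only [map_smul]

/-- **the bilinear form of a finite-rank self-adjoint operator is a finite sum**:
`⟪T x, y⟫ = ∑ i, ⟪b i, x⟫ · ⟪T (b i), y⟫`. -/
theorem inner_apply_eq_sum [CompleteSpace H] (T : H →L[ℂ] H) (hT : IsSelfAdjoint T)
    (b : OrthonormalBasis ι ℂ (range T)) (x y : H) :
    ⟪T x, y⟫_ℂ = ∑ i, (starRingEnd ℂ) ⟪(b i : H), x⟫_ℂ * ⟪T (b i), y⟫_ℂ := by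
  rw [apply_eq_sum T hT b x, sum_inner]
  simp only [inner_smul_left]

/-- the same with the conjugation on the other side: `⟪x, T y⟫ = ∑ i, ⟪x, T (b i)⟫ · ⟪b i, y⟫` -/
theorem inner_apply_eq_sum' [CompleteSpace H] (T : H →L[ℂ] H) (hT : IsSelfAdjoint T)
    (b : OrthonormalBasis ι ℂ (range T)) (x y : H) :
    ⟪x, T y⟫_ℂ = ∑ i, ⟪x, T (b i)⟫_ℂ * ⟪(b i : H), y⟫_ℂ := by
  rw [apply_eq_sum T hT b y, inner_sum]
  simp only [inner_smul_right]
  refine sum_congr rfl fun i _ => ?_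
  ring

end Summit.Ventures.HodgeRepro2.T7SupportFiniteRankSelfAdjoint
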